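import Literature.Analysis.Complex.StripPositivityRigidity
import Mathlib.Analysis.Complex.RemovableSingularity
import Mathlib.Topology.ExtendFrom

/-!
# Schwarz–Christoffel rigidity on the strip, I: reflection at a regular boundary point

Helper file for the crux `CardySusyWard.ParafermionFamiliesToSLESix` (stmt-CriticalPhenomena-10814),
line `exact-potential-schwarz-christoffel`, stub `stub_scRigidity` (pure complex analysis over Mathlib and
the tree's Schwarz reflection principle `Complex.differentiableOn_schwarzReflection`).

Setting: the open strip `S = {0 < im w < 1}`, its closure `{0 ≤ im w ≤ 1}`, a bounded function `f`
holomorphic on `S` and continuous on the closed strip whose trace on a real interval around `x₀` moves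
along a fixed line `e^{iθ} ℝ`.

* `exists_reflection` — `e^{-iθ} (f - f x₀)` reflects to a holomorphic function `F` on the ball
  `B(x₀, ρ)` with `‖F‖ ≤ 2M` and `f′ = e^{iθ} F′` on the upper half-ball;
* `norm_deriv_le_of_ball`, `norm_deriv_le_interior` — Cauchy estimates;
* `deriv_nonneg_of_trace` — if moreover the trace is monotone, `F′(x₀)` is a non-negative real;
* `tendsto_div_of_reflections` — for two such functions `g, h` with the same direction `θ` and
  `|g′| ≥ c > 0` near `x₀`, the quotient `h′/g′` has a non-negative real limit at `x₀` from inside `S`.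
-/

noncomputable section

namespace Summit.CriticalPhenomena.CardyFormulaZ2.Theorems.ParafermionFamiliesToSLESix.SCRigidity

open Complex Set Filter Metric Topology
open scoped ComplexConjugate Real

/-- The open strip is open. [folklore] -/
theorem isOpen_strip : IsOpen {w : ℂ | 0 < w.im ∧ w.im < 1} :=
  (isOpen_lt continuous_const continuous_im).inter (isOpen_lt continuous_im continuous_const)

/-- The closure of the open strip `{0 < im w < 1}` is the closed strip. [folklore] -/
theorem closure_strip :
    closure {w : ℂ | 0 < w.im ∧ w.im < 1} = {w : ℂ | 0 ≤ w.im ∧ w.im ≤ 1} := by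
  have h := closure_preimage_im (Ioo 0 1)
  rw [closure_Ioo zero_ne_one] at h
  simpa [Set.preimage, Set.ext_iff] using h

/-- Real points are in the closure of the open strip, so `𝓝[S] x₀` is non-trivial. [folklore] -/
theorem nhdsWithin_strip_neBot (x₀ : ℝ) :
    (𝓝[{w : ℂ | 0 < w.im ∧ w.im < 1}] (x₀ : ℂ)).NeBot :=
  mem_closure_iff_nhdsWithin_neBot.mp (by rw [closure_strip]; simp)

/-- Two points of an open interval free of breakpoints lie in the same segment. [folklore] -/
theorem sameSegment_of_mem_Ioo {B : Finset ℝ} {p q x y : ℝ} (hx : x ∈ Ioo p q) (hy : y ∈ Ioo p q)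
    (hB : ∀ b ∈ B, b ∉ Ioo p q) : ∀ b ∈ B, (x < b ↔ y < b) := by
  intro b hb
  have hb' : p < b → q ≤ b := by
    have := hB b hb
    simp only [mem_Ioo, not_and, not_lt] at this
    exact this
  rw [mem_Ioo] at hx hy
  constructor
  · intro hxb
    by_contra hyb
    exact absurd (hb' (hx.1.trans hxb)) (not_le.mpr ((not_lt.mp hyb).trans_lt hy.2))
  · intro hyb
    by_contra hxb
    exact absurd (hb' (hy.1.trans hyb)) (not_le.mpr ((not_lt.mp hxb).trans_lt hx.2))

/-- On a segment the trace increments are real in either order of the endpoints. [folklore] -/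
theorem trace_im_eq_zero {θ₀ : ℝ → ℝ} {B : Finset ℝ} {f : ℂ → ℂ}
    (hθ : ∀ x y : ℝ, (∀ b ∈ B, (x < b ↔ y < b)) → θ₀ x = θ₀ y)
    (htr : ∀ x y : ℝ, x ≤ y → (∀ b ∈ B, (x < b ↔ y < b)) →
      (exp (-(θ₀ x : ℂ) * I) * (f y - f x)).im = 0 ∧ 0 ≤ (exp (-(θ₀ x : ℂ) * I) * (f y - f x)).re)
    {x y : ℝ} (hxy : ∀ b ∈ B, (x < b ↔ y < b)) :
    (exp (-(θ₀ x : ℂ) * I) * (f y - f x)).im = 0 := by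
  rcases le_total x y with h | h
  · exact (htr x y h hxy).1
  · have hyx : ∀ b ∈ B, (y < b ↔ x < b) := fun b hb => (hxy b hb).symm
    have h1 := (htr y x h hyx).1
    rw [hθ y x hyx] at h1
    have : exp (-(θ₀ x : ℂ) * I) * (f y - f x) = -(exp (-(θ₀ x : ℂ) * I) * (f x - f y)) := by ring
    rw [this, neg_im, h1, neg_zero]

/-- **Schwarz reflection at a regular boundary point.** If `f` is holomorphic on the open strip,
continuous and bounded by `M` on the closed strip, and `e^{-iθ}(f y - f x₀)` is real for real `y` with
`|y - x₀| < ρ ≤ 1`, then `e^{-iθ}(f - f x₀)` reflects to a holomorphic `F` on `B(x₀, ρ)` with `‖F‖ ≤ 2M`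
and `f′ = e^{iθ} F′` on the upper half-ball (Conway, *Functions of One Complex Variable I*, IX.1.1, via the
tree's `Complex.differentiableOn_schwarzReflection`). [folklore] -/
theorem exists_reflection {f : ℂ → ℂ} {M x₀ ρ θ : ℝ} (hρ1 : ρ ≤ 1)
    (hd : DifferentiableOn ℂ f {w : ℂ | 0 < w.im ∧ w.im < 1})
    (hc : ContinuousOn f {w : ℂ | 0 ≤ w.im ∧ w.im ≤ 1})
    (hM : ∀ w ∈ {w : ℂ | 0 ≤ w.im ∧ w.im ≤ 1}, ‖f w‖ ≤ M)
    (hreal : ∀ y : ℝ, |y - x₀| < ρ → (exp (-(θ : ℂ) * I) * (f y - f x₀)).im = 0) :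
    ∃ F : ℂ → ℂ, DifferentiableOn ℂ F (ball (x₀ : ℂ) ρ) ∧
      (∀ w ∈ ball (x₀ : ℂ) ρ, 0 ≤ w.im → F w = exp (-(θ : ℂ) * I) * (f w - f x₀)) ∧
      (∀ w ∈ ball (x₀ : ℂ) ρ, ‖F w‖ ≤ 2 * M) ∧
      (∀ w ∈ ball (x₀ : ℂ) ρ, 0 < w.im → deriv f w = exp ((θ : ℂ) * I) * deriv F w) := by
  have him : ∀ w ∈ ball (x₀ : ℂ) ρ, |w.im| < 1 := by
    intro w hw
    rw [mem_ball, dist_eq_norm] at hw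
    have := abs_im_le_norm (w - x₀)
    simp only [sub_im, ofReal_im, sub_zero] at this
    linarith
  have hre : ∀ w ∈ ball (x₀ : ℂ) ρ, |w.re - x₀| < ρ := by
    intro w hw
    rw [mem_ball, dist_eq_norm] at hw
    have := abs_re_le_norm (w - x₀)
    simp only [sub_re, ofReal_re] at this
    linarith
  have hsymm : ∀ z ∈ ball (x₀ : ℂ) ρ, conj z ∈ ball (x₀ : ℂ) ρ := by
    intro z hz
    rw [mem_ball] at hz ⊢
    rwa [← conj_ofReal, dist_conj_conj]
  have hup : ball (x₀ : ℂ) ρ ∩ {z : ℂ | 0 ≤ z.im} ⊆ {w : ℂ | 0 ≤ w.im ∧ w.im ≤ 1} := by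
    rintro z ⟨hz, hz0⟩
    exact ⟨hz0, (abs_lt.mp (him z hz)).2.le⟩
  have hup' : ball (x₀ : ℂ) ρ ∩ {z : ℂ | 0 < z.im} ⊆ {w : ℂ | 0 < w.im ∧ w.im < 1} := by
    rintro z ⟨hz, hz0⟩
    exact ⟨hz0, (abs_lt.mp (him z hz)).2⟩
  set φ : ℂ → ℂ := fun w => exp (-(θ : ℂ) * I) * (f w - f x₀) with hφ
  have hφc : ContinuousOn φ (ball (x₀ : ℂ) ρ ∩ {z : ℂ | 0 ≤ z.im}) :=
    continuousOn_const.mul ((hc.mono hup).sub continuousOn_const)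
  have hφd : DifferentiableOn ℂ φ (ball (x₀ : ℂ) ρ ∩ {z : ℂ | 0 < z.im}) :=
    (differentiableOn_const _).mul ((hd.mono hup').sub (differentiableOn_const _))
  have hφreal : ∀ z ∈ ball (x₀ : ℂ) ρ, z.im = 0 → conj (φ z) = φ z := by
    intro z hz hz0
    have hz' : z = ((z.re : ℝ) : ℂ) := Complex.ext (by simp) (by simp [hz0])
    rw [conj_eq_iff_im, hφ, hz']
    exact hreal z.re (hre z hz)
  have hnorm : ‖exp (-(θ : ℂ) * I)‖ = 1 := by
    rw [show -(θ : ℂ) * I = ((-θ : ℝ) : ℂ) * I by push_cast; ring, norm_exp_ofReal_mul_I]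
  have hφM : ∀ w ∈ {w : ℂ | 0 ≤ w.im ∧ w.im ≤ 1}, ‖φ w‖ ≤ 2 * M := by
    intro w hw
    calc ‖φ w‖ = ‖f w - f x₀‖ := by rw [hφ]; dsimp only; rw [norm_mul, hnorm, one_mul]
      _ ≤ ‖f w‖ + ‖f x₀‖ := norm_sub_le _ _
      _ ≤ M + M := add_le_add (hM w hw) (hM _ ⟨by simp, by simp⟩)
      _ = 2 * M := by ring
  refine ⟨schwarzReflection φ, differentiableOn_schwarzReflection isOpen_ball hsymm hφc hφd hφreal,
    fun w _ hw0 => schwarzReflection_of_nonneg hw0, ?_, ?_⟩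
  · intro w hw
    rcases le_or_gt 0 w.im with h0 | h0
    · rw [schwarzReflection_of_nonneg h0]
      exact hφM w ⟨h0, (abs_lt.mp (him w hw)).2.le⟩
    · rw [schwarzReflection_of_neg h0, norm_conj]
      refine hφM (conj w) ⟨?_, ?_⟩
      · show 0 ≤ (conj w).im
        rw [conj_im]; linarith
      · show (conj w).im ≤ 1
        rw [conj_im]; have := (abs_lt.mp (him w hw)).1; linarith
  · intro w hw hw0
    have hev : schwarzReflection φ =ᶠ[𝓝 w] φ := by
      filter_upwards [(isOpen_lt continuous_const continuous_im).mem_nhds hw0] with y hy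
      exact schwarzReflection_of_nonneg (le_of_lt hy)
    rw [hev.deriv_eq]
    have hfw : DifferentiableAt ℂ f w :=
      hd.differentiableAt (isOpen_strip.mem_nhds ⟨hw0, (abs_lt.mp (him w hw)).2⟩)
    have : deriv φ w = exp (-(θ : ℂ) * I) * deriv f w := by
      rw [hφ, deriv_const_mul _ (hfw.sub_const _), deriv_sub_const]
    rw [this, ← mul_assoc, ← Complex.exp_add]
    simp

/-- Cauchy's estimate at points of the inner half of a ball on which the function is bounded by `K`:
`‖F′ w‖ ≤ 4K/ρ`. [folklore] -/
theorem norm_deriv_le_of_ball {F : ℂ → ℂ} {c : ℂ} {ρ K : ℝ} (hρ : 0 < ρ)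
    (hF : DifferentiableOn ℂ F (ball c ρ)) (hK : ∀ w ∈ ball c ρ, ‖F w‖ ≤ K)
    {w : ℂ} (hw : dist w c ≤ ρ / 2) : ‖deriv F w‖ ≤ 4 * K / ρ := by
  have hsub : closedBall w (ρ / 4) ⊆ ball c ρ :=
    closedBall_subset_ball' (by linarith)
  have h1 := Complex.norm_deriv_le_of_forall_mem_sphere_norm_le (by positivity : 0 < ρ / 4)
    (hF.diffContOnCl_ball hsub) (fun z hz => hK z (hsub (sphere_subset_closedBall hz)))
  calc ‖deriv F w‖ ≤ K / (ρ / 4) := h1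
    _ = 4 * K / ρ := by rw [div_div_eq_mul_div]; ring

/-- Interior Cauchy estimate in the lower half of the strip: `‖f′ w‖ ≤ M / im w`. [folklore] -/
theorem norm_deriv_le_interior {f : ℂ → ℂ} {M : ℝ}
    (hd : DifferentiableOn ℂ f {w : ℂ | 0 < w.im ∧ w.im < 1})
    (hc : ContinuousOn f {w : ℂ | 0 ≤ w.im ∧ w.im ≤ 1})
    (hM : ∀ w ∈ {w : ℂ | 0 ≤ w.im ∧ w.im ≤ 1}, ‖f w‖ ≤ M)
    {w : ℂ} (hw0 : 0 < w.im) (hw1 : w.im ≤ 1 / 2) : ‖deriv f w‖ ≤ M / w.im := by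
  have him : ∀ z, |z.im - w.im| ≤ dist z w := fun z => by
    rw [dist_eq_norm]; simpa using abs_im_le_norm (z - w)
  have hball : ball w w.im ⊆ {w : ℂ | 0 < w.im ∧ w.im < 1} := by
    intro z hz
    rw [mem_ball] at hz
    have := abs_lt.mp (lt_of_le_of_lt (him z) hz)
    exact ⟨by linarith [this.1], by linarith [this.2]⟩
  have hcball : closedBall w w.im ⊆ {w : ℂ | 0 ≤ w.im ∧ w.im ≤ 1} := by
    intro z hz
    rw [mem_closedBall] at hz
    have := abs_le.mp ((him z).trans hz)
    exact ⟨by linarith [this.1], by linarith [this.2]⟩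
  exact Complex.norm_deriv_le_of_forall_mem_sphere_norm_le hw0
    (DiffContOnCl.mk_ball (hd.mono hball) (hc.mono hcball))
    (fun z hz => hM z (hcball (sphere_subset_closedBall hz)))

/-- If `F` is holomorphic on `B(x₀, ρ)`, vanishes at `x₀` and takes non-negative real values on
`(x₀, x₀ + ρ)`, then `F′(x₀)` is a non-negative real. [folklore] -/
theorem deriv_nonneg_of_trace {F : ℂ → ℂ} {x₀ ρ : ℝ} (hρ : 0 < ρ)
    (hF : DifferentiableOn ℂ F (ball (x₀ : ℂ) ρ)) (h0 : F x₀ = 0)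
    (hpos : ∀ y : ℝ, x₀ < y → y < x₀ + ρ → (F y).im = 0 ∧ 0 ≤ (F y).re) :
    (deriv F x₀).im = 0 ∧ 0 ≤ (deriv F x₀).re := by
  have hFd : HasDerivAt F (deriv F x₀) x₀ :=
    (hF.differentiableAt (isOpen_ball.mem_nhds (mem_ball_self hρ))).hasDerivAt
  have hR : HasDerivAt (fun t : ℝ => F t) (deriv F x₀) x₀ := hFd.comp_ofReal
  rw [hasDerivAt_iff_tendsto_slope] at hR
  have hR' : Tendsto (slope (fun t : ℝ => F t) x₀) (𝓝[>] x₀) (𝓝 (deriv F x₀)) :=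
    hR.mono_left (nhdsWithin_mono _ (fun t ht => ne_of_gt ht))
  have hCl : IsClosed {z : ℂ | z.im = 0 ∧ 0 ≤ z.re} :=
    (isClosed_eq continuous_im continuous_const).inter (isClosed_le continuous_const continuous_re)
  have hmem : ∀ᶠ t in 𝓝[>] x₀, slope (fun t : ℝ => F t) x₀ t ∈ {z : ℂ | z.im = 0 ∧ 0 ≤ z.re} := by
    filter_upwards [Ioo_mem_nhdsGT (show x₀ < x₀ + ρ by linarith)] with t ht
    rw [slope_def_module, h0, sub_zero]
    obtain ⟨h1, h2⟩ := hpos t ht.1 ht.2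
    have ht0 : 0 < t - x₀ := by linarith [ht.1]
    refine ⟨by simp [h1], ?_⟩
    simp only [Complex.smul_re, smul_eq_mul]
    exact mul_nonneg (inv_nonneg.mpr ht0.le) h2
  exact hCl.mem_of_tendsto hR' hmem

/-- **The quotient `h′/g′` at a regular boundary point.** Two bounded holomorphic functions `g, h`
on the strip with real traces along the same direction `e^{iθ}` near `x₀`, monotone to the right of
`x₀`, and `|g′| ≥ c > 0` on the upper half-ball: then `h′/g′ → L` at `x₀` from inside the strip, with
`L ≥ 0` real (`L = H′(x₀)/G′(x₀)` for the two reflections). [folklore] -/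
theorem tendsto_div_of_reflections {g h : ℂ → ℂ} {M x₀ ρ θ c : ℝ} (hρ : 0 < ρ) (hρ1 : ρ ≤ 1)
    (hc0 : 0 < c)
    (hgd : DifferentiableOn ℂ g {w : ℂ | 0 < w.im ∧ w.im < 1})
    (hgc : ContinuousOn g {w : ℂ | 0 ≤ w.im ∧ w.im ≤ 1})
    (hgM : ∀ w ∈ {w : ℂ | 0 ≤ w.im ∧ w.im ≤ 1}, ‖g w‖ ≤ M)
    (hhd : DifferentiableOn ℂ h {w : ℂ | 0 < w.im ∧ w.im < 1})
    (hhc : ContinuousOn h {w : ℂ | 0 ≤ w.im ∧ w.im ≤ 1})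
    (hhM : ∀ w ∈ {w : ℂ | 0 ≤ w.im ∧ w.im ≤ 1}, ‖h w‖ ≤ M)
    (hg_real : ∀ y : ℝ, |y - x₀| < ρ → (exp (-(θ : ℂ) * I) * (g y - g x₀)).im = 0)
    (hh_real : ∀ y : ℝ, |y - x₀| < ρ → (exp (-(θ : ℂ) * I) * (h y - h x₀)).im = 0)
    (hg_pos : ∀ y : ℝ, x₀ < y → y < x₀ + ρ → 0 ≤ (exp (-(θ : ℂ) * I) * (g y - g x₀)).re)
    (hh_pos : ∀ y : ℝ, x₀ < y → y < x₀ + ρ → 0 ≤ (exp (-(θ : ℂ) * I) * (h y - h x₀)).re)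
    (hlow : ∀ w ∈ ball (x₀ : ℂ) ρ, 0 < w.im → c ≤ ‖deriv g w‖) :
    ∃ L : ℝ, 0 ≤ L ∧ Tendsto (fun w => deriv h w / deriv g w)
      (𝓝[{w : ℂ | 0 < w.im ∧ w.im < 1}] (x₀ : ℂ)) (𝓝 (L : ℂ)) := by
  obtain ⟨G, hGd, hGeq, -, hGder⟩ := exists_reflection hρ1 hgd hgc hgM hg_real
  obtain ⟨H, hHd, hHeq, -, hHder⟩ := exists_reflection hρ1 hhd hhc hhM hh_real
  have hball : ball (x₀ : ℂ) ρ ∈ 𝓝 (x₀ : ℂ) := isOpen_ball.mem_nhds (mem_ball_self hρ)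
  have hGc : ContinuousAt (deriv G) x₀ := ((hGd.analyticAt hball).deriv).continuousAt
  have hHc : ContinuousAt (deriv H) x₀ := ((hHd.analyticAt hball).deriv).continuousAt
  have hyball : ∀ y : ℝ, x₀ < y → y < x₀ + ρ → (y : ℂ) ∈ ball (x₀ : ℂ) ρ := by
    intro y h1 h2
    rw [mem_ball, dist_eq_norm, ← ofReal_sub, norm_real, Real.norm_eq_abs, abs_lt]
    constructor <;> linarith
  have hG0 : G x₀ = 0 := by rw [hGeq _ (mem_ball_self hρ) (by simp)]; simp
  have hH0 : H x₀ = 0 := by rw [hHeq _ (mem_ball_self hρ) (by simp)]; simp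
  have hGpos : ∀ y : ℝ, x₀ < y → y < x₀ + ρ → (G y).im = 0 ∧ 0 ≤ (G y).re := by
    intro y h1 h2
    rw [hGeq _ (hyball y h1 h2) (by simp)]
    exact ⟨hg_real y (by rw [abs_lt]; constructor <;> linarith), hg_pos y h1 h2⟩
  have hHpos : ∀ y : ℝ, x₀ < y → y < x₀ + ρ → (H y).im = 0 ∧ 0 ≤ (H y).re := by
    intro y h1 h2
    rw [hHeq _ (hyball y h1 h2) (by simp)]
    exact ⟨hh_real y (by rw [abs_lt]; constructor <;> linarith), hh_pos y h1 h2⟩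
  obtain ⟨hGi, hGr⟩ := deriv_nonneg_of_trace hρ hGd hG0 hGpos
  obtain ⟨hHi, hHr⟩ := deriv_nonneg_of_trace hρ hHd hH0 hHpos
  haveI := nhdsWithin_strip_neBot x₀
  have hev : ∀ᶠ w in 𝓝[{w : ℂ | 0 < w.im ∧ w.im < 1}] (x₀ : ℂ),
      w ∈ ball (x₀ : ℂ) ρ ∧ w ∈ {w : ℂ | 0 < w.im ∧ w.im < 1} := by
    filter_upwards [mem_nhdsWithin_of_mem_nhds hball, self_mem_nhdsWithin] with w h1 h2
    exact ⟨h1, h2⟩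
  have hGn : c ≤ ‖deriv G x₀‖ := by
    have ht : Tendsto (fun w => ‖deriv G w‖) (𝓝[{w : ℂ | 0 < w.im ∧ w.im < 1}] (x₀ : ℂ))
        (𝓝 ‖deriv G x₀‖) := (hGc.tendsto.mono_left nhdsWithin_le_nhds).norm
    refine ge_of_tendsto ht ?_
    filter_upwards [hev] with w hw
    have hn : ‖deriv g w‖ = ‖deriv G w‖ := by
      rw [hGder w hw.1 hw.2.1, norm_mul, norm_exp_ofReal_mul_I, one_mul]
    rw [← hn]
    exact hlow w hw.1 hw.2.1
  have hGne : deriv G x₀ ≠ 0 := fun h0 => by rw [h0, norm_zero] at hGn; linarith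
  have ha : deriv H x₀ = (((deriv H x₀).re : ℝ) : ℂ) := Complex.ext (by simp) (by simp [hHi])
  have hd' : deriv G x₀ = (((deriv G x₀).re : ℝ) : ℂ) := Complex.ext (by simp) (by simp [hGi])
  have hdpos : 0 < (deriv G x₀).re := by
    refine lt_of_le_of_ne hGr (fun h0 => hGne ?_)
    rw [hd', ← h0]; simp
  refine ⟨(deriv H x₀).re / (deriv G x₀).re, div_nonneg hHr hdpos.le, ?_⟩
  have hlim : Tendsto (fun w => deriv H w / deriv G w) (𝓝[{w : ℂ | 0 < w.im ∧ w.im < 1}] (x₀ : ℂ))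
      (𝓝 (deriv H x₀ / deriv G x₀)) :=
    ((hHc.div hGc hGne).tendsto).mono_left nhdsWithin_le_nhds
  have heq : (((deriv H x₀).re / (deriv G x₀).re : ℝ) : ℂ) = deriv H x₀ / deriv G x₀ := by
    rw [ofReal_div, ← ha, ← hd']
  rw [heq]
  refine hlim.congr' ?_
  filter_upwards [hev] with w hw
  rw [hHder w hw.1 hw.2.1, hGder w hw.1 hw.2.1, mul_div_mul_left _ _ (Complex.exp_ne_zero _)]

/-- **Far-field derivative bound.** If the trace of `f` is real along `e^{iθ}` on `(x₀ - 1, x₀ + 1)`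
then `‖f′ w‖ ≤ 8M` for `w` in the strip with `dist w x₀ ≤ 1/2` (reflection in the ball `B(x₀, 1)` and
Cauchy's estimate). [folklore] -/
theorem norm_deriv_le_far {f : ℂ → ℂ} {M x₀ θ : ℝ}
    (hd : DifferentiableOn ℂ f {w : ℂ | 0 < w.im ∧ w.im < 1})
    (hc : ContinuousOn f {w : ℂ | 0 ≤ w.im ∧ w.im ≤ 1})
    (hM : ∀ w ∈ {w : ℂ | 0 ≤ w.im ∧ w.im ≤ 1}, ‖f w‖ ≤ M)
    (hreal : ∀ y : ℝ, |y - x₀| < 1 → (exp (-(θ : ℂ) * I) * (f y - f x₀)).im = 0)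
    {w : ℂ} (hw : dist w x₀ ≤ 1 / 2) (hw0 : 0 < w.im) : ‖deriv f w‖ ≤ 8 * M := by
  obtain ⟨F, hFd, -, hFM, hFder⟩ := exists_reflection le_rfl hd hc hM hreal
  have hwb : w ∈ ball (x₀ : ℂ) 1 := by rw [mem_ball]; linarith
  rw [hFder w hwb hw0, norm_mul, norm_exp_ofReal_mul_I, one_mul]
  calc ‖deriv F w‖ ≤ 4 * (2 * M) / 1 := norm_deriv_le_of_ball one_pos hFd hFM hw
    _ = 8 * M := by ring

/-- **Derivative bound near an isolated breakpoint.** If `f` has real traces (along some direction)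
on every interval `|y - x| < |x - b|` with `0 < |x - b| < r₁ ≤ 1/2`, then `‖f′ w‖ ≤ 12M/|w - b|` for
`w` in the strip with `|w - b| < r₁` (interior Cauchy estimate if `|re w - b| ≤ 2 im w`, reflection at
`re w` with radius `|re w - b|` otherwise). [folklore] -/
theorem norm_deriv_le_near_breakpoint {f : ℂ → ℂ} {M b r₁ : ℝ} (hr₁ : r₁ ≤ 1 / 2) (hM0 : 0 ≤ M)
    (hd : DifferentiableOn ℂ f {w : ℂ | 0 < w.im ∧ w.im < 1})
    (hc : ContinuousOn f {w : ℂ | 0 ≤ w.im ∧ w.im ≤ 1})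
    (hM : ∀ w ∈ {w : ℂ | 0 ≤ w.im ∧ w.im ≤ 1}, ‖f w‖ ≤ M)
    (hreal : ∀ x : ℝ, x ≠ b → |x - b| < r₁ → ∃ θ : ℝ, ∀ y : ℝ, |y - x| < |x - b| →
      (exp (-(θ : ℂ) * I) * (f y - f x)).im = 0)
    {w : ℂ} (hw : w ∈ ball (b : ℂ) r₁) (hw0 : 0 < w.im) : ‖deriv f w‖ ≤ 12 * M / ‖w - b‖ := by
  have hwb : ‖w - b‖ < r₁ := by rwa [mem_ball, dist_eq_norm] at hw
  have hre_le : |w.re - b| ≤ ‖w - b‖ := by simpa using abs_re_le_norm (w - b)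
  have him_le : w.im ≤ ‖w - b‖ := by
    have := abs_im_le_norm (w - b)
    simp only [sub_im, ofReal_im, sub_zero] at this
    exact (le_abs_self _).trans this
  have hnorm_le : ‖w - b‖ ≤ |w.re - b| + w.im := by
    have := norm_le_abs_re_add_abs_im (w - b)
    simpa [abs_of_pos hw0] using this
  have hpos : 0 < ‖w - b‖ := lt_of_lt_of_le hw0 him_le
  have ht1 : w.im ≤ 1 / 2 := by linarith
  rcases le_or_gt |w.re - b| (2 * w.im) with hat | hat
  · calc ‖deriv f w‖ ≤ M / w.im := norm_deriv_le_interior hd hc hM hw0 ht1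
      _ ≤ 12 * M / ‖w - b‖ := by
        rw [div_le_div_iff₀ hw0 hpos]
        nlinarith
  · have ha0 : 0 < |w.re - b| := by linarith
    have hxb : w.re ≠ b := fun h => by simp [h] at ha0
    obtain ⟨θ, hθ⟩ := hreal w.re hxb (by linarith)
    obtain ⟨F, hFd, -, hFM, hFder⟩ :=
      exists_reflection (x₀ := w.re) (ρ := |w.re - b|) (by linarith) hd hc hM hθ
    have hwre : w - (w.re : ℂ) = (w.im : ℂ) * I := Complex.ext (by simp) (by simp)
    have hdist : dist w (w.re : ℂ) = w.im := by
      rw [dist_eq_norm, hwre, norm_mul, norm_real, norm_I, mul_one, Real.norm_eq_abs,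
        abs_of_pos hw0]
    have hwball : w ∈ ball ((w.re : ℝ) : ℂ) |w.re - b| := by rw [mem_ball, hdist]; linarith
    rw [hFder w hwball hw0, norm_mul, norm_exp_ofReal_mul_I, one_mul]
    calc ‖deriv F w‖ ≤ 4 * (2 * M) / |w.re - b| :=
          norm_deriv_le_of_ball ha0 hFd hFM (by rw [hdist]; linarith)
      _ ≤ 12 * M / ‖w - b‖ := by
        rw [div_le_div_iff₀ ha0 hpos]
        nlinarith

end Summit.CriticalPhenomena.CardyFormulaZ2.Theorems.ParafermionFamiliesToSLESix.SCRigidity
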